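import Mathlib
import Literature.AlgebraicGeometry.Resolution.CobordantGame
import Literature.AlgebraicGeometry.Resolution.CobordantChartCoefficients
import Literature.AlgebraicGeometry.Resolution.CobordantChartPlaneSlice
import Literature.AlgebraicGeometry.Resolution.PowerSeriesRegularLocal
import Summits.ResolutionOfSingularities.ResolutionOfSingularities.Theorems.WeightedInvariantLocalWeightedDropSliceChart

/-!
# `LocalWeightedDrop`: the `u₂`-chart of the point blow-up and the `u₁`-chart of the curve blow-up, in the polygon files' format

Route `ResolutionOfSingularities/WeightedInvariant`, crux `LocalWeightedDrop` (stmt-ResolutionOfSingularities-8899), line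
`hasse-ridge-face-selection` (chain w43, [OURS · L1 W4.3]); bridge (a), step 2 continued (companion of
`…LocalWeightedDropPointChartTransport`, which treats the `u₁`-chart of the point blow-up).  `R = R′ = k[[X₀, X₁, X₂]]`
(`(y, u₁, u₂) = (X₀, X₁, X₂)`), `φ` = substitution along the restricted chart of `…LocalWeightedDropSliceChart`.
* `span_eq_maximalIdeal_of_mem` — three elements of `𝔪` through which the variables are expressible generate `𝔪`;
* POINT BLOW-UP, `u₂`-CHART (`ChartTwoPolygonLaws`: `c′₂ = φ u₂`, `φ y = φ u₂ · c′₀`, `φ u₁ = φ u₂ · c′₁`): exceptional point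
  `c` with `c₂ ≠ 0`, slice at the slot `2`, `ρ = (s(c₀ + y₀), s(c₁ + y₁), s c₂)`, translated parameters
  `c̃ = (X₀ − (c₀/c₂) X₂, X₁ − (c₁/c₂) X₂, X₂)`, `c′ = (c₂⁻¹ X₁, c₂⁻¹ X₂, c₂ X₀)` — `substTwo_ct_two/zero/one`,
  `span_ctTwo_eq_maximalIdeal`, `span_cprimeTwo_eq_maximalIdeal`, `substTwo_rho_eq`;
* CURVE BLOW-UP of `V(y, u₁)` (weights `(1, 1, 0)`; `CurveBlowupPolygonLaws`: `c′₁ = φ u₁`, `φ y = φ u₁ · c′₀`, `c′₂ = φ u₂`),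
  `u₁`-chart: exceptional point `(c₀, c₁, 0)` with `c₁ ≠ 0`, slice at the slot `1`, `ρ = (s(c₀ + y₀), s c₁, y₂)`,
  `c̃ = (X₀ − (c₀/c₁) X₁, X₁, X₂)`, `c′ = (c₁⁻¹ X₁, c₁ X₀, X₂)` — `substCurve_ct_one/zero/two`, `span_ctCurve_eq_maximalIdeal`,
  `span_cprimeCurve_eq_maximalIdeal`, `substCurve_rho_eq`.
-/

set_option linter.dupNamespace false -- mandated namespace of this single-conjunct summit

namespace Summit.ResolutionOfSingularities.ResolutionOfSingularities.Theorems

open Literature.AlgebraicGeometry.Resolution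

namespace PointChartTransport

variable {k : Type} [Field k]

/-- Three elements of the maximal ideal of `k[[X₀, X₁, X₂]]` in terms of which the three variables are expressible generate it. -/
theorem span_eq_maximalIdeal_of_mem (e : Fin 3 → MvPowerSeries (Fin 3) k)
    (he : ∀ i, e i ∈ IsLocalRing.maximalIdeal (MvPowerSeries (Fin 3) k))
    (hX : ∀ i : Fin 3, (MvPowerSeries.X i : MvPowerSeries (Fin 3) k) ∈ Ideal.span {e 0, e 1, e 2}) :
    Ideal.span {e 0, e 1, e 2} = IsLocalRing.maximalIdeal (MvPowerSeries (Fin 3) k) := by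
  apply le_antisymm
  · rw [Ideal.span_le]
    intro x hx
    simp only [Set.mem_insert_iff, Set.mem_singleton_iff] at hx
    rcases hx with rfl | rfl | rfl <;> exact he _
  · rw [maximalIdeal_mvPowerSeries_eq_span, Ideal.span_le]
    rintro _ ⟨i, rfl⟩
    exact hX i

/-- Membership of the generators in their span. -/
theorem mem_span_triple (e : Fin 3 → MvPowerSeries (Fin 3) k) (i : Fin 3) : e i ∈ Ideal.span {e 0, e 1, e 2} := by
  refine Ideal.subset_span ?_
  fin_cases i <;> simp

/-! ### Point blow-up, `u₂`-chart -/

/-- The restricted chart of the point blow-up at `c`, sliced at the slot `2`, is substitutable. -/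
theorem hasSubst_rhoTwo (c : Fin 3 → k) :
    MvPowerSeries.HasSubst (fun l : Fin 3 => MvPowerSeries.X (0 : Fin 3) ^ ((fun _ : Fin 3 => 1) l) *
      (MvPowerSeries.C (c l) + if l = (2 : Fin 3) then (0 : MvPowerSeries (Fin 3) k)
        else MvPowerSeries.X (Fin.predAbove (2 : Fin 3) l.succ))) :=
  MvPowerSeries.hasSubst_of_constantCoeff_zero fun l => by simp [MvPowerSeries.constantCoeff_X]

/-- `h₂` of the `u₂`-chart: `φ u₂ = c₂ · s`. -/
theorem substTwo_ct_two (c : Fin 3 → k) :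
    MvPowerSeries.subst (fun l : Fin 3 => MvPowerSeries.X (0 : Fin 3) ^ ((fun _ : Fin 3 => 1) l) *
      (MvPowerSeries.C (c l) + if l = (2 : Fin 3) then (0 : MvPowerSeries (Fin 3) k)
        else MvPowerSeries.X (Fin.predAbove (2 : Fin 3) l.succ))) (MvPowerSeries.X 2 : MvPowerSeries (Fin 3) k) =
      MvPowerSeries.C (c 2) * MvPowerSeries.X 0 := by
  rw [MvPowerSeries.subst_X (hasSubst_rhoTwo c)]
  simp only [if_true, pow_one, add_zero]
  ring

/-- `h₀` of the `u₂`-chart: `φ (X₀ − (c₀/c₂) X₂) = φ u₂ · (c₂⁻¹ X₁)`. -/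
theorem substTwo_ct_zero (c : Fin 3 → k) (hc2 : c 2 ≠ 0) :
    MvPowerSeries.subst (fun l : Fin 3 => MvPowerSeries.X (0 : Fin 3) ^ ((fun _ : Fin 3 => 1) l) *
      (MvPowerSeries.C (c l) + if l = (2 : Fin 3) then (0 : MvPowerSeries (Fin 3) k)
        else MvPowerSeries.X (Fin.predAbove (2 : Fin 3) l.succ)))
        (MvPowerSeries.X 0 - MvPowerSeries.C (c 0 / c 2) * MvPowerSeries.X 2) =
      (MvPowerSeries.C (c 2) * MvPowerSeries.X 0) * (MvPowerSeries.C (c 2)⁻¹ * MvPowerSeries.X 1) := by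
  have hρ := hasSubst_rhoTwo c
  rw [MvPowerSeries.subst_sub hρ, MvPowerSeries.subst_mul hρ, MvPowerSeries.subst_C, MvPowerSeries.subst_X hρ,
    MvPowerSeries.subst_X hρ]
  have h : Fin.predAbove (2 : Fin 3) (0 : Fin 3).succ = 1 := by decide
  simp only [show ((0 : Fin 3) = 2) = False by decide, if_false, if_true, pow_one, add_zero, h]
  have hc : MvPowerSeries.C (c 0 / c 2) * MvPowerSeries.C (c 2) = (MvPowerSeries.C (c 0) : MvPowerSeries (Fin 3) k) := by
    rw [← map_mul, div_mul_cancel₀ _ hc2]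
  have hc' : MvPowerSeries.C (c 2) * MvPowerSeries.C (c 2)⁻¹ = (1 : MvPowerSeries (Fin 3) k) := by
    rw [← map_mul, mul_inv_cancel₀ hc2, map_one]
  linear_combination (-(MvPowerSeries.X 0 : MvPowerSeries (Fin 3) k)) * hc -
    (MvPowerSeries.X 0 * MvPowerSeries.X 1 : MvPowerSeries (Fin 3) k) * hc'

/-- `h₁` of the `u₂`-chart: `φ (X₁ − (c₁/c₂) X₂) = φ u₂ · (c₂⁻¹ X₂)`. -/
theorem substTwo_ct_one (c : Fin 3 → k) (hc2 : c 2 ≠ 0) :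
    MvPowerSeries.subst (fun l : Fin 3 => MvPowerSeries.X (0 : Fin 3) ^ ((fun _ : Fin 3 => 1) l) *
      (MvPowerSeries.C (c l) + if l = (2 : Fin 3) then (0 : MvPowerSeries (Fin 3) k)
        else MvPowerSeries.X (Fin.predAbove (2 : Fin 3) l.succ)))
        (MvPowerSeries.X 1 - MvPowerSeries.C (c 1 / c 2) * MvPowerSeries.X 2) =
      (MvPowerSeries.C (c 2) * MvPowerSeries.X 0) * (MvPowerSeries.C (c 2)⁻¹ * MvPowerSeries.X 2) := by
  have hρ := hasSubst_rhoTwo c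
  rw [MvPowerSeries.subst_sub hρ, MvPowerSeries.subst_mul hρ, MvPowerSeries.subst_C, MvPowerSeries.subst_X hρ,
    MvPowerSeries.subst_X hρ]
  have h : Fin.predAbove (2 : Fin 3) (1 : Fin 3).succ = 2 := by decide
  simp only [show ((1 : Fin 3) = 2) = False by decide, if_false, if_true, pow_one, add_zero, h]
  have hc : MvPowerSeries.C (c 1 / c 2) * MvPowerSeries.C (c 2) = (MvPowerSeries.C (c 1) : MvPowerSeries (Fin 3) k) := by
    rw [← map_mul, div_mul_cancel₀ _ hc2]
  have hc' : MvPowerSeries.C (c 2) * MvPowerSeries.C (c 2)⁻¹ = (1 : MvPowerSeries (Fin 3) k) := by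
    rw [← map_mul, mul_inv_cancel₀ hc2, map_one]
  linear_combination (-(MvPowerSeries.X 0 : MvPowerSeries (Fin 3) k)) * hc -
    (MvPowerSeries.X 0 * MvPowerSeries.X 2 : MvPowerSeries (Fin 3) k) * hc'

/-- `hgen` of the `u₂`-chart: `c̃ = (X₀ − (c₀/c₂) X₂, X₁ − (c₁/c₂) X₂, X₂)` generate `𝔪`. -/
theorem span_ctTwo_eq_maximalIdeal (c : Fin 3 → k) :
    Ideal.span {(MvPowerSeries.X 0 - MvPowerSeries.C (c 0 / c 2) * MvPowerSeries.X 2 : MvPowerSeries (Fin 3) k),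
      MvPowerSeries.X 1 - MvPowerSeries.C (c 1 / c 2) * MvPowerSeries.X 2, MvPowerSeries.X 2} =
      IsLocalRing.maximalIdeal (MvPowerSeries (Fin 3) k) := by
  have hXm : ∀ i : Fin 3, (MvPowerSeries.X i : MvPowerSeries (Fin 3) k) ∈ IsLocalRing.maximalIdeal _ :=
    fun i => X_mem_maximalIdeal k (Fin 3) i
  refine span_eq_maximalIdeal_of_mem ![MvPowerSeries.X 0 - MvPowerSeries.C (c 0 / c 2) * MvPowerSeries.X 2,
    MvPowerSeries.X 1 - MvPowerSeries.C (c 1 / c 2) * MvPowerSeries.X 2, MvPowerSeries.X 2] (fun i => ?_) (fun i => ?_)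
  · fin_cases i
    · exact Ideal.sub_mem _ (hXm 0) (Ideal.mul_mem_left _ _ (hXm 2))
    · exact Ideal.sub_mem _ (hXm 1) (Ideal.mul_mem_left _ _ (hXm 2))
    · exact hXm 2
  · have h2 := mem_span_triple (k := k) ![MvPowerSeries.X 0 - MvPowerSeries.C (c 0 / c 2) * MvPowerSeries.X 2,
      MvPowerSeries.X 1 - MvPowerSeries.C (c 1 / c 2) * MvPowerSeries.X 2, MvPowerSeries.X 2] 2
    fin_cases i
    · have h0 := mem_span_triple (k := k) ![MvPowerSeries.X 0 - MvPowerSeries.C (c 0 / c 2) * MvPowerSeries.X 2,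
        MvPowerSeries.X 1 - MvPowerSeries.C (c 1 / c 2) * MvPowerSeries.X 2, MvPowerSeries.X 2] 0
      have := Ideal.add_mem _ h0 (Ideal.mul_mem_left _ (MvPowerSeries.C (c 0 / c 2)) h2)
      simpa using this
    · have h1 := mem_span_triple (k := k) ![MvPowerSeries.X 0 - MvPowerSeries.C (c 0 / c 2) * MvPowerSeries.X 2,
        MvPowerSeries.X 1 - MvPowerSeries.C (c 1 / c 2) * MvPowerSeries.X 2, MvPowerSeries.X 2] 1
      have := Ideal.add_mem _ h1 (Ideal.mul_mem_left _ (MvPowerSeries.C (c 1 / c 2)) h2)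
      simpa using this
    · simpa using h2

/-- `hgen′` of the `u₂`-chart: `c′ = (c₂⁻¹ X₁, c₂⁻¹ X₂, c₂ X₀)` generate `𝔪` (`c₂ ≠ 0`). -/
theorem span_cprimeTwo_eq_maximalIdeal (c : Fin 3 → k) (hc2 : c 2 ≠ 0) :
    Ideal.span {(MvPowerSeries.C (c 2)⁻¹ * MvPowerSeries.X 1 : MvPowerSeries (Fin 3) k),
      MvPowerSeries.C (c 2)⁻¹ * MvPowerSeries.X 2, MvPowerSeries.C (c 2) * MvPowerSeries.X 0} =
      IsLocalRing.maximalIdeal (MvPowerSeries (Fin 3) k) := by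
  have hXm : ∀ i : Fin 3, (MvPowerSeries.X i : MvPowerSeries (Fin 3) k) ∈ IsLocalRing.maximalIdeal _ :=
    fun i => X_mem_maximalIdeal k (Fin 3) i
  have hinv : (MvPowerSeries.C (c 2) * MvPowerSeries.C (c 2)⁻¹ : MvPowerSeries (Fin 3) k) = 1 := by
    rw [← map_mul, mul_inv_cancel₀ hc2, map_one]
  have hinv' : (MvPowerSeries.C (c 2)⁻¹ * MvPowerSeries.C (c 2) : MvPowerSeries (Fin 3) k) = 1 := by
    rw [← map_mul, inv_mul_cancel₀ hc2, map_one]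
  set e : Fin 3 → MvPowerSeries (Fin 3) k := ![MvPowerSeries.C (c 2)⁻¹ * MvPowerSeries.X 1,
    MvPowerSeries.C (c 2)⁻¹ * MvPowerSeries.X 2, MvPowerSeries.C (c 2) * MvPowerSeries.X 0] with he
  refine span_eq_maximalIdeal_of_mem e (fun i => ?_) (fun i => ?_)
  · fin_cases i
    · exact Ideal.mul_mem_left _ _ (hXm 1)
    · exact Ideal.mul_mem_left _ _ (hXm 2)
    · exact Ideal.mul_mem_left _ _ (hXm 0)
  · fin_cases i
    · have hmem : (MvPowerSeries.C (c 2) * MvPowerSeries.X 0 : MvPowerSeries (Fin 3) k) ∈ Ideal.span {e 0, e 1, e 2} :=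
        mem_span_triple e 2
      have h := Ideal.mul_mem_left _ (MvPowerSeries.C (c 2)⁻¹) hmem
      rw [← mul_assoc, hinv', one_mul] at h
      exact h
    · have hmem : (MvPowerSeries.C (c 2)⁻¹ * MvPowerSeries.X 1 : MvPowerSeries (Fin 3) k) ∈ Ideal.span {e 0, e 1, e 2} :=
        mem_span_triple e 0
      have h := Ideal.mul_mem_left _ (MvPowerSeries.C (c 2)) hmem
      rw [← mul_assoc, hinv, one_mul] at h
      exact h
    · have hmem : (MvPowerSeries.C (c 2)⁻¹ * MvPowerSeries.X 2 : MvPowerSeries (Fin 3) k) ∈ Ideal.span {e 0, e 1, e 2} :=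
        mem_span_triple e 1
      have h := Ideal.mul_mem_left _ (MvPowerSeries.C (c 2)) hmem
      rw [← mul_assoc, hinv, one_mul] at h
      exact h

/-- THE WEAK TRANSFORM OF THE `u₂`-CHART IS GENERATED BY THE SLICE: `φ f = (φ c̃₂)^a · (c₂^{-a} · Sl)`. -/
theorem substTwo_rho_eq (c : Fin 3 → k) (hc2 : c 2 ≠ 0) (f : MvPowerSeries (Fin 3) k) (a : ℕ)
    (G : MvPowerSeries (Fin 4) k)
    (hfac : MvPowerSeries.subst (CobordantChart.chart (fun _ : Fin 3 => 1) c) f = MvPowerSeries.X 0 ^ a * G) :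
    MvPowerSeries.subst (fun l : Fin 3 => MvPowerSeries.X (0 : Fin 3) ^ ((fun _ : Fin 3 => 1) l) *
      (MvPowerSeries.C (c l) + if l = (2 : Fin 3) then (0 : MvPowerSeries (Fin 3) k)
        else MvPowerSeries.X (Fin.predAbove (2 : Fin 3) l.succ))) f =
      (MvPowerSeries.C (c 2) * MvPowerSeries.X 0) ^ a *
        (MvPowerSeries.C ((c 2)⁻¹ ^ a) * MvPowerSeries.subst (fun j : Fin 4 => if j = (2 : Fin 3).succ then
          (0 : MvPowerSeries (Fin 3) k) else MvPowerSeries.X (Fin.predAbove (2 : Fin 3) j)) G) := by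
  rw [SliceChart.subst_restrictedChart (fun _ : Fin 3 => 1) c (fun l hl => absurd hl one_ne_zero) f a G hfac 2,
    mul_pow, ← map_pow]
  have hc : (MvPowerSeries.C (c 2 ^ a) * MvPowerSeries.C ((c 2)⁻¹ ^ a) : MvPowerSeries (Fin 3) k) = 1 := by
    rw [← map_mul, ← mul_pow, mul_inv_cancel₀ hc2, one_pow, map_one]
  linear_combination (-(MvPowerSeries.X 0 ^ a * MvPowerSeries.subst (fun j : Fin 4 => if j = (2 : Fin 3).succ then
    (0 : MvPowerSeries (Fin 3) k) else MvPowerSeries.X (Fin.predAbove (2 : Fin 3) j)) G)) * hc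

/-! ### Curve blow-up of `V(y, u₁)` (weights `(1, 1, 0)`), `u₁`-chart -/

/-- The restricted chart of the curve blow-up at `c = (c₀, c₁, 0)`, sliced at the slot `1`, is substitutable. -/
theorem hasSubst_rhoCurve (c : Fin 3 → k) (hc2 : c 2 = 0) :
    MvPowerSeries.HasSubst (fun l : Fin 3 => MvPowerSeries.X (0 : Fin 3) ^ ((![1, 1, 0] : Fin 3 → ℕ) l) *
      (MvPowerSeries.C (c l) + if l = (1 : Fin 3) then (0 : MvPowerSeries (Fin 3) k)
        else MvPowerSeries.X (Fin.predAbove (1 : Fin 3) l.succ))) := by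
  refine MvPowerSeries.hasSubst_of_constantCoeff_zero fun l => ?_
  fin_cases l
  · simp [MvPowerSeries.constantCoeff_X]
  · simp [MvPowerSeries.constantCoeff_X]
  · simp [MvPowerSeries.constantCoeff_X, hc2]

/-- `h₁` of the curve chart: `φ u₁ = c₁ · s`. -/
theorem substCurve_ct_one (c : Fin 3 → k) (hc2 : c 2 = 0) :
    MvPowerSeries.subst (fun l : Fin 3 => MvPowerSeries.X (0 : Fin 3) ^ ((![1, 1, 0] : Fin 3 → ℕ) l) *
      (MvPowerSeries.C (c l) + if l = (1 : Fin 3) then (0 : MvPowerSeries (Fin 3) k)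
        else MvPowerSeries.X (Fin.predAbove (1 : Fin 3) l.succ))) (MvPowerSeries.X 1 : MvPowerSeries (Fin 3) k) =
      MvPowerSeries.C (c 1) * MvPowerSeries.X 0 := by
  rw [MvPowerSeries.subst_X (hasSubst_rhoCurve c hc2)]
  simp only [if_true, add_zero, Matrix.cons_val_one, Matrix.cons_val_zero, pow_one]
  ring

/-- `h₀` of the curve chart: `φ (X₀ − (c₀/c₁) X₁) = φ u₁ · (c₁⁻¹ X₁)` for `c₁ ≠ 0`. -/
theorem substCurve_ct_zero (c : Fin 3 → k) (hc1 : c 1 ≠ 0) (hc2 : c 2 = 0) :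
    MvPowerSeries.subst (fun l : Fin 3 => MvPowerSeries.X (0 : Fin 3) ^ ((![1, 1, 0] : Fin 3 → ℕ) l) *
      (MvPowerSeries.C (c l) + if l = (1 : Fin 3) then (0 : MvPowerSeries (Fin 3) k)
        else MvPowerSeries.X (Fin.predAbove (1 : Fin 3) l.succ)))
        (MvPowerSeries.X 0 - MvPowerSeries.C (c 0 / c 1) * MvPowerSeries.X 1) =
      (MvPowerSeries.C (c 1) * MvPowerSeries.X 0) * (MvPowerSeries.C (c 1)⁻¹ * MvPowerSeries.X 1) := by
  have hρ := hasSubst_rhoCurve c hc2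
  rw [MvPowerSeries.subst_sub hρ, MvPowerSeries.subst_mul hρ, MvPowerSeries.subst_C, MvPowerSeries.subst_X hρ,
    MvPowerSeries.subst_X hρ]
  have h10 : Fin.predAbove (1 : Fin 3) (0 : Fin 3).succ = 1 := by decide
  simp only [show ((0 : Fin 3) = 1) = False by decide, if_false, if_true, pow_one, add_zero, h10,
    Matrix.cons_val_zero, Matrix.cons_val_one]
  have hc : MvPowerSeries.C (c 0 / c 1) * MvPowerSeries.C (c 1) = (MvPowerSeries.C (c 0) : MvPowerSeries (Fin 3) k) := by
    rw [← map_mul, div_mul_cancel₀ _ hc1]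
  have hc' : MvPowerSeries.C (c 1) * MvPowerSeries.C (c 1)⁻¹ = (1 : MvPowerSeries (Fin 3) k) := by
    rw [← map_mul, mul_inv_cancel₀ hc1, map_one]
  linear_combination (-(MvPowerSeries.X 0 : MvPowerSeries (Fin 3) k)) * hc -
    (MvPowerSeries.X 0 * MvPowerSeries.X 1 : MvPowerSeries (Fin 3) k) * hc'

/-- `h₂` of the curve chart: `φ u₂ = u₂` (`c′₂ = X₂`). -/
theorem substCurve_ct_two (c : Fin 3 → k) (hc2 : c 2 = 0) :
    MvPowerSeries.subst (fun l : Fin 3 => MvPowerSeries.X (0 : Fin 3) ^ ((![1, 1, 0] : Fin 3 → ℕ) l) *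
      (MvPowerSeries.C (c l) + if l = (1 : Fin 3) then (0 : MvPowerSeries (Fin 3) k)
        else MvPowerSeries.X (Fin.predAbove (1 : Fin 3) l.succ))) (MvPowerSeries.X 2 : MvPowerSeries (Fin 3) k) =
      MvPowerSeries.X 2 := by
  rw [MvPowerSeries.subst_X (hasSubst_rhoCurve c hc2)]
  have h12 : Fin.predAbove (1 : Fin 3) (2 : Fin 3).succ = 2 := by decide
  simp only [show ((2 : Fin 3) = 1) = False by decide, if_false, hc2, map_zero, zero_add, h12, pow_zero, one_mul,
    Matrix.cons_val_two, Matrix.tail_cons, Matrix.head_cons]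

/-- `hgen` of the curve chart: `c̃ = (X₀ − (c₀/c₁) X₁, X₁, X₂)` generate `𝔪`. -/
theorem span_ctCurve_eq_maximalIdeal (c : Fin 3 → k) :
    Ideal.span {(MvPowerSeries.X 0 - MvPowerSeries.C (c 0 / c 1) * MvPowerSeries.X 1 : MvPowerSeries (Fin 3) k),
      MvPowerSeries.X 1, MvPowerSeries.X 2} = IsLocalRing.maximalIdeal (MvPowerSeries (Fin 3) k) := by
  have hXm : ∀ i : Fin 3, (MvPowerSeries.X i : MvPowerSeries (Fin 3) k) ∈ IsLocalRing.maximalIdeal _ :=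
    fun i => X_mem_maximalIdeal k (Fin 3) i
  set e : Fin 3 → MvPowerSeries (Fin 3) k := ![MvPowerSeries.X 0 - MvPowerSeries.C (c 0 / c 1) * MvPowerSeries.X 1,
    MvPowerSeries.X 1, MvPowerSeries.X 2] with he
  refine span_eq_maximalIdeal_of_mem e (fun i => ?_) (fun i => ?_)
  · fin_cases i
    · exact Ideal.sub_mem _ (hXm 0) (Ideal.mul_mem_left _ _ (hXm 1))
    · exact hXm 1
    · exact hXm 2
  · have h1 : (MvPowerSeries.X 1 : MvPowerSeries (Fin 3) k) ∈ Ideal.span {e 0, e 1, e 2} := mem_span_triple e 1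
    fin_cases i
    · have h0 : (MvPowerSeries.X 0 - MvPowerSeries.C (c 0 / c 1) * MvPowerSeries.X 1 : MvPowerSeries (Fin 3) k) ∈
          Ideal.span {e 0, e 1, e 2} := mem_span_triple e 0
      have := Ideal.add_mem _ h0 (Ideal.mul_mem_left _ (MvPowerSeries.C (c 0 / c 1)) h1)
      simpa using this
    · exact h1
    · exact (mem_span_triple e 2 : (MvPowerSeries.X 2 : MvPowerSeries (Fin 3) k) ∈ _)

/-- `hgen′` of the curve chart: `c′ = (c₁⁻¹ X₁, c₁ X₀, X₂)` generate `𝔪` (`c₁ ≠ 0`). -/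
theorem span_cprimeCurve_eq_maximalIdeal (c : Fin 3 → k) (hc1 : c 1 ≠ 0) :
    Ideal.span {(MvPowerSeries.C (c 1)⁻¹ * MvPowerSeries.X 1 : MvPowerSeries (Fin 3) k),
      MvPowerSeries.C (c 1) * MvPowerSeries.X 0, MvPowerSeries.X 2} = IsLocalRing.maximalIdeal (MvPowerSeries (Fin 3) k) := by
  have hXm : ∀ i : Fin 3, (MvPowerSeries.X i : MvPowerSeries (Fin 3) k) ∈ IsLocalRing.maximalIdeal _ :=
    fun i => X_mem_maximalIdeal k (Fin 3) i
  have hinv : (MvPowerSeries.C (c 1) * MvPowerSeries.C (c 1)⁻¹ : MvPowerSeries (Fin 3) k) = 1 := by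
    rw [← map_mul, mul_inv_cancel₀ hc1, map_one]
  have hinv' : (MvPowerSeries.C (c 1)⁻¹ * MvPowerSeries.C (c 1) : MvPowerSeries (Fin 3) k) = 1 := by
    rw [← map_mul, inv_mul_cancel₀ hc1, map_one]
  set e : Fin 3 → MvPowerSeries (Fin 3) k := ![MvPowerSeries.C (c 1)⁻¹ * MvPowerSeries.X 1,
    MvPowerSeries.C (c 1) * MvPowerSeries.X 0, MvPowerSeries.X 2] with he
  refine span_eq_maximalIdeal_of_mem e (fun i => ?_) (fun i => ?_)
  · fin_cases i
    · exact Ideal.mul_mem_left _ _ (hXm 1)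
    · exact Ideal.mul_mem_left _ _ (hXm 0)
    · exact hXm 2
  · fin_cases i
    · have hmem : (MvPowerSeries.C (c 1) * MvPowerSeries.X 0 : MvPowerSeries (Fin 3) k) ∈ Ideal.span {e 0, e 1, e 2} :=
        mem_span_triple e 1
      have h := Ideal.mul_mem_left _ (MvPowerSeries.C (c 1)⁻¹) hmem
      rw [← mul_assoc, hinv', one_mul] at h
      exact h
    · have hmem : (MvPowerSeries.C (c 1)⁻¹ * MvPowerSeries.X 1 : MvPowerSeries (Fin 3) k) ∈ Ideal.span {e 0, e 1, e 2} :=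
        mem_span_triple e 0
      have h := Ideal.mul_mem_left _ (MvPowerSeries.C (c 1)) hmem
      rw [← mul_assoc, hinv, one_mul] at h
      exact h
    · exact (mem_span_triple e 2 : (MvPowerSeries.X 2 : MvPowerSeries (Fin 3) k) ∈ _)

/-- THE WEAK TRANSFORM OF THE CURVE CHART IS GENERATED BY THE SLICE: `φ f = (φ c̃₁)^a · (c₁^{-a} · Sl)`. -/
theorem substCurve_rho_eq (c : Fin 3 → k) (hc1 : c 1 ≠ 0) (hc2 : c 2 = 0) (f : MvPowerSeries (Fin 3) k) (a : ℕ)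
    (G : MvPowerSeries (Fin 4) k)
    (hfac : MvPowerSeries.subst (CobordantChart.chart (![1, 1, 0] : Fin 3 → ℕ) c) f = MvPowerSeries.X 0 ^ a * G) :
    MvPowerSeries.subst (fun l : Fin 3 => MvPowerSeries.X (0 : Fin 3) ^ ((![1, 1, 0] : Fin 3 → ℕ) l) *
      (MvPowerSeries.C (c l) + if l = (1 : Fin 3) then (0 : MvPowerSeries (Fin 3) k)
        else MvPowerSeries.X (Fin.predAbove (1 : Fin 3) l.succ))) f =
      (MvPowerSeries.C (c 1) * MvPowerSeries.X 0) ^ a *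
        (MvPowerSeries.C ((c 1)⁻¹ ^ a) * MvPowerSeries.subst (fun j : Fin 4 => if j = (1 : Fin 3).succ then
          (0 : MvPowerSeries (Fin 3) k) else MvPowerSeries.X (Fin.predAbove (1 : Fin 3) j)) G) := by
  have hconv : ∀ l : Fin 3, (![1, 1, 0] : Fin 3 → ℕ) l = 0 → c l = 0 := by
    intro l hl
    fin_cases l
    · exact absurd hl (by simp)
    · exact absurd hl (by simp)
    · exact hc2
  rw [SliceChart.subst_restrictedChart (![1, 1, 0] : Fin 3 → ℕ) c hconv f a G hfac 1, mul_pow, ← map_pow]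
  have hc : (MvPowerSeries.C (c 1 ^ a) * MvPowerSeries.C ((c 1)⁻¹ ^ a) : MvPowerSeries (Fin 3) k) = 1 := by
    rw [← map_mul, ← mul_pow, mul_inv_cancel₀ hc1, one_pow, map_one]
  linear_combination (-(MvPowerSeries.X 0 ^ a * MvPowerSeries.subst (fun j : Fin 4 => if j = (1 : Fin 3).succ then
    (0 : MvPowerSeries (Fin 3) k) else MvPowerSeries.X (Fin.predAbove (1 : Fin 3) j)) G)) * hc

end PointChartTransport

end Summit.ResolutionOfSingularities.ResolutionOfSingularities.Theorems
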